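import Mathlib
import HarnessLib
import Summits.QuantumFields.YangMills.Theorems.MirrorModularBoostsHypercubicLimitMixedCoeff
import Summits.QuantumFields.YangMills.Theorems.MirrorModularBoostsHypercubicLimitResponseSmooth
import Literature.MathematicalPhysics.QuantumLattice.WilsonFeynmanHellmann

/-!
# The diagonal values of the mixed coefficients are derivatives of the tilted expectation

Helper file 2/4 for stub `stub_derivToMoments` of line `Sketch` (coupling response) of crux `HypercubicLimit`
(stmt-QuantumFields-16154).  For bounded measurable `X`, `W` on a probability space, the mixed coefficients of the
moment recursion (`mixedCoeff`, file `…MixedCoeff.lean`) on a family constantly equal to `W` are the real derivatives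
at `0` of the modulated one-point function `t ↦ ∫ X d(μ.tilted (tW))` — one-variable Leibniz for `N = g · Z`
(`N(t) = ∫ X e^{tW}`, `Z = mgf W μ`), regrouped by cardinality.  No cumulant theory is used.
-/

noncomputable section

open MeasureTheory Finset

namespace Summit.QuantumFields.YangMills.Cruxes.HypercubicLimit.CouplingResponse

/-! ## The diagonal values are the derivatives of the tilted expectation -/

section Diagonal

open ProbabilityTheory Literature.MathematicalPhysics.QuantumLattice

variable {Ω : Type*} [MeasurableSpace Ω] {μ : Measure Ω}

/-- `e^{tW}` is bounded measurable for bounded measurable `W`. [folklore] -/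
theorem IsBddMeas.exp_const_mul {W : Ω → ℝ} (hW : IsBddMeas W) (t : ℝ) :
    IsBddMeas (fun ω => Real.exp (t * W ω)) := by
  obtain ⟨hWm, C, hC⟩ := hW
  refine ⟨Real.measurable_exp.comp (hWm.const_mul t), Real.exp (|t| * C), fun ω => ?_⟩
  rw [abs_of_pos (Real.exp_pos _)]
  refine Real.exp_le_exp.2 ?_
  calc t * W ω ≤ |t * W ω| := le_abs_self _
    _ = |t| * |W ω| := abs_mul _ _
    _ ≤ |t| * C := mul_le_mul_of_nonneg_left (hC ω) (abs_nonneg t)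

/-- **All derivatives of a weighted Laplace transform of bounded observables** (finite measure):
`(d/ds)^m ∫ F e^{sW} dμ = ∫ F W^m e^{sW} dμ`, by iterating `responseSmooth_hasDerivAt_integral_mul_exp`. [folklore] -/
theorem iteratedDeriv_integral_mul_exp [IsFiniteMeasure μ] {W : Ω → ℝ} (hW : Measurable W) {CW : ℝ}
    (hbW : ∀ ω, |W ω| ≤ CW) :
    ∀ (m : ℕ) (F : Ω → ℝ), Measurable F → ∀ C : ℝ, (∀ ω, |F ω| ≤ C) →
      iteratedDeriv m (fun s => ∫ ω, F ω * Real.exp (s * W ω) ∂μ) =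
        fun s => ∫ ω, F ω * W ω ^ m * Real.exp (s * W ω) ∂μ := by
  intro m
  induction m with
  | zero =>
    intro F _ C _
    funext s
    simp
  | succ m ih =>
    intro F hF C hC
    rw [iteratedDeriv_succ']
    have hd : deriv (fun s => ∫ ω, F ω * Real.exp (s * W ω) ∂μ) =
        fun s => ∫ ω, F ω * W ω * Real.exp (s * W ω) ∂μ :=
      funext fun t => (responseSmooth_hasDerivAt_integral_mul_exp hW hbW hF hC t).deriv
    rw [hd, ih (fun ω => F ω * W ω) (hF.mul hW) (C * CW) fun ω => by
      rw [abs_mul]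
      exact mul_le_mul (hC ω) (hbW ω) (abs_nonneg _) ((abs_nonneg _).trans (hC ω))]
    funext s
    refine integral_congr_ae (ae_of_all _ fun ω => ?_)
    simp only [pow_succ]
    ring

variable [IsProbabilityMeasure μ]

/-- **The tilting recursion.**  For bounded measurable `X`, `W` on a probability space and
`g(t) = ∫ X d(μ.tilted (tW))`: `g^{(n)}(0) = ∫ X Wⁿ dμ − Σ_{i<n} C(n,i) g^{(i)}(0) ∫ W^{n−i} dμ` — the one-variable
Leibniz rule for `N = g · Z` (`N(t) = ∫ X e^{tW} dμ`, `Z(t) = ∫ e^{tW} dμ = mgf W μ t > 0`) at `t = 0`, with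
`N^{(n)}(0) = ∫ X Wⁿ`, `Z^{(m)}(0) = ∫ W^m`, `Z(0) = 1`. [folklore] -/
theorem iteratedDeriv_tilted_recursion {X W : Ω → ℝ} (hX : IsBddMeas X) (hW : IsBddMeas W) (n : ℕ) :
    iteratedDeriv n (fun t => ∫ ω, X ω ∂(μ.tilted (fun ω => t * W ω))) 0 =
      (∫ ω, X ω * W ω ^ n ∂μ) -
        ∑ i ∈ range n, (n.choose i : ℝ) *
          iteratedDeriv i (fun t => ∫ ω, X ω ∂(μ.tilted (fun ω => t * W ω))) 0 * ∫ ω, W ω ^ (n - i) ∂μ := by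
  obtain ⟨hXm, CX, hCX⟩ := hX
  obtain ⟨hWm, CW, hCW⟩ := hW
  set g : ℝ → ℝ := fun t => ∫ ω, X ω ∂(μ.tilted (fun ω => t * W ω)) with hg_def
  set N : ℝ → ℝ := fun t => ∫ ω, X ω * Real.exp (t * W ω) ∂μ with hN_def
  -- the integrability interval of `e^{tW}` is all of `ℝ`
  have hset : integrableExpSet W μ = Set.univ :=
    integrableExpSet_eq_univ_of_abs_le hWm.aemeasurable (ae_of_all _ hCW)
  have hint : ∀ t : ℝ, t ∈ interior (integrableExpSet W μ) := fun t => by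
    rw [hset, interior_univ]; trivial
  have hZpos : ∀ t : ℝ, 0 < mgf W μ t := fun t =>
    mgf_pos ((IsBddMeas.exp_const_mul ⟨hWm, CW, hCW⟩ t).integrable μ)
  -- `g = N / Z`, so `N = g · Z`
  have hgNZ : ∀ t, g t = N t / mgf W μ t := fun t =>
    integral_tilted_eq_integral_mul_exp_div_mgf X t
  have hNeq : N = fun t => g t * mgf W μ t := by
    funext t
    rw [hgNZ t, div_mul_cancel₀ _ (hZpos t).ne']
  -- smoothness
  have hgs : ContDiff ℝ (⊤ : ℕ∞) g :=
    responseSmooth_contDiff_integral_tilted (μ := μ) hXm hWm hCX hCW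
  have hZs : ContDiffAt ℝ n (mgf W μ) 0 := (analyticAt_mgf (hint 0)).contDiffAt
  -- Leibniz at `0`
  have hL := iteratedDeriv_fun_mul (n := n) (x := (0 : ℝ)) (f := g) (g := mgf W μ)
    (contDiff_infty.1 hgs n).contDiffAt hZs
  rw [← hNeq] at hL
  -- the derivatives of `N` and `Z` at `0`
  have hN : iteratedDeriv n N 0 = ∫ ω, X ω * W ω ^ n ∂μ := by
    rw [hN_def, iteratedDeriv_integral_mul_exp hWm hCW n X hXm CX hCX]
    simp
  have hZ : ∀ m, iteratedDeriv m (mgf W μ) 0 = ∫ ω, W ω ^ m ∂μ := fun m => by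
    rw [iteratedDeriv_mgf_zero (hint 0)]
    rfl
  rw [hN, sum_range_succ, Nat.choose_self, Nat.cast_one, one_mul, Nat.sub_self, hZ 0] at hL
  simp only [pow_zero, integral_const, probReal_univ, smul_eq_mul, mul_one] at hL
  simp_rw [hZ] at hL
  linarith

/-- **The diagonal values of the mixed coefficients are the derivatives of the tilted expectation.**  For bounded
measurable `X`, `W` on a probability space and a family constantly equal to `W` on `s`,
`A_X(s) = (d/dt)^{|s|} |_{t=0} ∫ X d(μ.tilted (tW))` — the mixed coefficients of the moment recursion ARE the
Taylor coefficients of the modulated one-point function (joint cumulants with the modulation repeated). [folklore] -/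
theorem mixedCoeff_const_eq_iteratedDeriv {ι : Type*} [DecidableEq ι] {X W : Ω → ℝ} (hX : IsBddMeas X)
    (hW : IsBddMeas W) {Y : ι → Ω → ℝ} (s : Finset ι) (hY : ∀ i ∈ s, Y i = W) :
    mixedCoeff μ X Y s = iteratedDeriv s.card (fun t => ∫ ω, X ω ∂(μ.tilted (fun ω => t * W ω))) 0 := by
  induction s using Finset.strongInduction with
  | H s ih =>
    rw [mixedCoeff_eq, iteratedDeriv_tilted_recursion hX hW s.card]
    have hprod : ∀ (u : Finset ι), u ⊆ s → ∀ ω, ∏ i ∈ u, Y i ω = W ω ^ u.card := fun u hu ω => by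
      rw [← prod_const]
      exact prod_congr rfl fun i hi => by rw [hY i (hu hi)]
    simp_rw [hprod s Subset.rfl]
    congr 1
    -- regroup the sum over proper subsets by cardinality
    have hterm : ∀ t ∈ s.ssubsets, mixedCoeff μ X Y t * ∫ ω, ∏ i ∈ s \ t, Y i ω ∂μ =
        (fun m : ℕ => iteratedDeriv m (fun t => ∫ ω, X ω ∂(μ.tilted (fun ω => t * W ω))) 0 *
          ∫ ω, W ω ^ (s.card - m) ∂μ) t.card := by
      intro t ht
      have hts := mem_ssubsets.1 ht
      rw [ih t hts fun i hi => hY i (hts.subset hi)]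
      simp_rw [hprod (s \ t) sdiff_subset, card_sdiff_of_subset hts.subset]
    rw [sum_congr rfl hterm]
    have hsplit := Finset.sum_powerset_apply_card
      (fun m : ℕ => iteratedDeriv m (fun t => ∫ ω, X ω ∂(μ.tilted (fun ω => t * W ω))) 0 *
        ∫ ω, W ω ^ (s.card - m) ∂μ) (x := s)
    rw [← Finset.sum_erase_add _ _ (mem_powerset_self s), sum_range_succ, Nat.choose_self] at hsplit
    have h : s.powerset.erase s = s.ssubsets := rfl
    rw [h] at hsplit
    simp only [nsmul_eq_mul, one_smul] at hsplit
    have hcancel := add_right_cancel (b := (fun m : ℕ => iteratedDeriv m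
        (fun t => ∫ ω, X ω ∂(μ.tilted (fun ω => t * W ω))) 0 * ∫ ω, W ω ^ (s.card - m) ∂μ) s.card)
      (hsplit.trans (by ring))
    rw [hcancel]
    refine sum_congr rfl fun m _ => ?_
    ring

end Diagonal

/-- **Registered sub-goal `mixedCoeff_diagonal` (line `Sketch`, stub `stub_derivToMoments`)**: on a constant family the
mixed coefficients are the derivatives at `0` of the tilted expectation (closed form of
`mixedCoeff_const_eq_iteratedDeriv`). [folklore] -/
theorem mixedCoeff_diagonal :
    ∀ (Ω : Type) [MeasurableSpace Ω] (μ : Measure Ω) [IsProbabilityMeasure μ] (X W : Ω → ℝ), IsBddMeas X → IsBddMeas W → ∀ (n : ℕ), mixedCoeff μ X (fun _ : Fin n => W) univ = iteratedDeriv n (fun t => ∫ ω, X ω ∂(μ.tilted (fun ω => t * W ω))) 0 := by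
  intro Ω _ μ _ X W hX hW n
  have h := mixedCoeff_const_eq_iteratedDeriv (μ := μ) hX hW (Y := fun _ : Fin n => W) univ (fun _ _ => rfl)
  simpa only [card_univ, Fintype.card_fin] using h

end Summit.QuantumFields.YangMills.Cruxes.HypercubicLimit.CouplingResponse

end
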